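import Summits.QuantumFields.YangMills.Theorems.BalabanLadderUVSeamRecCeilingsPolymerRarityMoments
import HarnessLib

/-!
# Crux `UVSeamRec` (stmt-QuantumFields-20043), slot `stub_ceilings` (E0′): the v5 glue — plane-resolved ceilings at a
# target unit from a tempered centre law and a polymer law each delivered AT ITS OWN UNIT inside a one-sided window

Helper file (`--kind proof --supports stmt-QuantumFields-20043 --as helper`) of the unit `ym-20043-tempered-d1` (D2 enabler;
owner R86e (1): «composition := p528131 `momentBounds6_of_temperedLaw_and_polymerLaw` ⊕ flow window»).  HONEST FRAMING: unit
bookkeeping around ceilings-p2's consumption theorem (p528131); both inputs — (a) the TEMPERED centre law for exteriors of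
influence `< θ` and (PL)+`hnum` the Peierls product law of the large-field polymer gas with its numerical side condition — are OPEN
renormalisation-group statements, the two stubs of the v5 shape of `stub_ceilings`; nothing of them and nothing of E0′ is asserted
here.  Not a gap, not Clay.

WHAT IT DOES.  p528131 takes (a), `hnum` and (PL) at ONE unit map `a` with ONE pair of thresholds `(β₁, ℓ₁)` and returns
`MomentBounds6 G r a`.  The v5 stubs deliver (a) at a unit `a` (Bałaban's), (PL)+`hnum` at a unit `a′`, each only known to satisfy
a ONE-SIDED WINDOW `a ≤ c·u`, `a′ ≤ c′·u` eventually towards the target unit `u` (the unit of record `uRec`; the honest content of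
«asymptotic scaling of the flow of record», cf. `CeilingsTransfer.momentBounds6_of_eventually_le`, p442252), with their own
thresholds.  Since every hypothesis sees its unit ONLY through the guard `R · a β ≤ ℓ₁`, the target guard `R · u β ≤ min(ℓ₁/c, ℓ₁′/c′)`
implies both source guards for `β ≥ max(β₁, β₀, β₁′, β₀′)`:
* `guards_of_windows` — that bookkeeping;
* `momentBounds6_of_temperedLaw_and_polymerLaw_windows` — (a)-in-a-window + ((PL)+`hnum`)-in-a-window ⇒ `MomentBounds6 G r u`
  (p528131 at the unit `u`), for a measurable influence functional `I` and a constant threshold `θ`.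
The v5 skeleton (`Cruxes/UVSeamRec/Lines/…`, owner's pen) applies the second theorem at `G = SU(2)`, `r = rF`, `u = uRec`,
`I = PolymerData.influenceAt 𝔟 ε kmax` (p531519 ∕ sibling).

References: H.-O. Georgii, *Gibbs Measures and Phase Transitions* (2011) Thm. 4.17 (DLR part, via p518354/p528131); the intended
inputs are of the kind of T. Bałaban, Commun. Math. Phys. 122 (1989) 175–202 / 355–392.
-/

set_option autoImplicit false

noncomputable section

open MeasureTheory Filter Topology
open Literature.MathematicalPhysics.QuantumFieldTheory (GaugeConfig LatticeRep)
open Literature.MathematicalPhysics.QuantumLattice (LGConfig torusLift)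
open Summit.QuantumFields.YangMills.Cruxes.OSLegsFromFemtoAndGap.DlrCollarTransfer
open Summit.QuantumFields.YangMills.Cruxes.UVSeamRec.PolymerRarity (momentBounds6_of_temperedLaw_and_polymerLaw)

namespace Summit.QuantumFields.YangMills.Cruxes.UVSeamRec.PolymerGlue

/-- **TWO ONE-SIDED WINDOWS, ONE TARGET GUARD.**  If `a ≤ c·u` and `a′ ≤ c′·u` eventually (`c, c′ > 0`), then there are a threshold
`B ≥ β₁, β₁′` and a range `ℓ > 0` with `ℓ ≤ ℓ₁/c`, `ℓ ≤ ℓ₁′/c′` such that for `β ≥ B` the target guard `R · u β ≤ ℓ` implies both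
source guards `R · a β ≤ ℓ₁`, `R · a′ β ≤ ℓ₁′`. [folklore] -/
theorem guards_of_windows {a a' u : ℝ → ℝ} {c c' β₁ β₁' ℓ₁ ℓ₁' : ℝ} (hc : 0 < c) (hc' : 0 < c')
    (hℓ₁ : 0 < ℓ₁) (hℓ₁' : 0 < ℓ₁')
    (hle : ∀ᶠ β in atTop, a β ≤ c * u β) (hle' : ∀ᶠ β in atTop, a' β ≤ c' * u β) :
    ∃ B ℓ : ℝ, 0 < ℓ ∧ ∀ β : ℝ, B ≤ β → β₁ ≤ β ∧ β₁' ≤ β ∧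
      ∀ R : ℕ, (R : ℝ) * u β ≤ ℓ → (R : ℝ) * a β ≤ ℓ₁ ∧ (R : ℝ) * a' β ≤ ℓ₁' := by
  obtain ⟨β₀, hβ₀⟩ := Filter.eventually_atTop.1 hle
  obtain ⟨β₀', hβ₀'⟩ := Filter.eventually_atTop.1 hle'
  refine ⟨max (max β₁ β₀) (max β₁' β₀'), min (ℓ₁ / c) (ℓ₁' / c'), lt_min (div_pos hℓ₁ hc) (div_pos hℓ₁' hc'),
    fun β hβ => ⟨?_, ?_, fun R hR => ⟨?_, ?_⟩⟩⟩
  · exact le_trans (le_trans (le_max_left _ _) (le_max_left _ _)) hβ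
  · exact le_trans (le_trans (le_max_left _ _) (le_max_right _ _)) hβ
  · have ha : a β ≤ c * u β := hβ₀ β (le_trans (le_trans (le_max_right _ _) (le_max_left _ _)) hβ)
    have hR0 : (0 : ℝ) ≤ R := Nat.cast_nonneg R
    have h1 : (R : ℝ) * u β ≤ ℓ₁ / c := hR.trans (min_le_left _ _)
    rw [le_div_iff₀ hc] at h1
    calc (R : ℝ) * a β ≤ R * (c * u β) := mul_le_mul_of_nonneg_left ha hR0
      _ = R * u β * c := by ring
      _ ≤ ℓ₁ := h1
  · have ha : a' β ≤ c' * u β := hβ₀' β (le_trans (le_trans (le_max_right _ _) (le_max_right _ _)) hβ)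
    have hR0 : (0 : ℝ) ≤ R := Nat.cast_nonneg R
    have h1 : (R : ℝ) * u β ≤ ℓ₁' / c' := hR.trans (min_le_right _ _)
    rw [le_div_iff₀ hc'] at h1
    calc (R : ℝ) * a' β ≤ R * (c' * u β) := mul_le_mul_of_nonneg_left ha hR0
      _ = R * u β * c' := by ring
      _ ≤ ℓ₁' := h1

variable {G : Type} [Group G] [TopologicalSpace G] [IsTopologicalGroup G] [CompactSpace G]
  [MeasurableSpace G] [BorelSpace G]

/-- **`MomentBounds6 G r u` FROM A TEMPERED CENTRE LAW IN A WINDOW AND A POLYMER LAW IN A WINDOW (the v5 composition).**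
Data: a measurable influence functional `I β R q x : LGConfig 4 G → ℝ` and a constant threshold `θ` (the tempered class is
`{η | I β R q x η < θ}`).  Hypotheses: (a) at SOME unit `a` with `a ≤ c·u` eventually, constants `C₁ ≥ 0`, `ℓ₁ > 0`, `β₁`, means
`|p| ≤ P₀`: for `β ≥ β₁`, `1 ≤ R`, `R·a β ≤ ℓ₁`, every orientation `q.1 < q.2`, site `x` and exterior `η` with `I β R q x η < θ`, the
cube-kernel mean of `plane q x` over the radius-`(R+1)` cube around `x` is within `C₁/R⁴` of `p q β`; and ((PL)+`hnum`) at SOME unit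
`a′` with `a′ ≤ c′·u` eventually: tilts `λ ≥ 0`, budgets `Λ`, `W`, `C₂ ≥ 0`, `ℓ₁′ > 0`, `β₁′` with
`exp(λ e^{λΛ} W − λθ) ≤ C₂/R⁴` on the guard and, on every odd torus `2L+1 ≥ 4R+8` and cyclically `2R+4`-separated cube family, a
finite measurable polymer system dominating `I` with the Peierls product law under the Wilson state (p528131's (PL) verbatim).
THEN `MomentBounds6 G r u`.  Proof: `guards_of_windows` moves all three hypotheses to the unit `u` (they see their unit only
through the guard `R·a ≤ ℓ₁`), then ceilings-p2's `momentBounds6_of_temperedLaw_and_polymerLaw` at the unit `u`.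
[folklore: Georgii (2011) Thm. 4.17 for the DLR part] -/
theorem momentBounds6_of_temperedLaw_and_polymerLaw_windows (r : LatticeRep G) (u : ℝ → ℝ)
    (I : ℝ → ℕ → Fin 4 × Fin 4 → (Fin 4 → ℤ) → LGConfig 4 G → ℝ) (θ : ℝ)
    (hIm : ∀ β R q x, Measurable (I β R q x))
    (hlawW : ∃ (a : ℝ → ℝ) (c C₁ β₁ ℓ₁ P₀ : ℝ) (p : Fin 4 × Fin 4 → ℝ → ℝ),
      0 < c ∧ (∀ᶠ β in atTop, a β ≤ c * u β) ∧ 0 < ℓ₁ ∧ 0 ≤ C₁ ∧ (∀ q β, |p q β| ≤ P₀) ∧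
      ∀ β : ℝ, β₁ ≤ β → ∀ R : ℕ, 1 ≤ R → (R : ℝ) * a β ≤ ℓ₁ →
        ∀ (q : Fin 4 × Fin 4) (x : Fin 4 → ℤ), q.1 < q.2 → ∀ η : LGConfig 4 G, I β R q x η < θ →
          |kerE G r β (fun k => x k - (R + 1)) (2 * R + 3) η (plane G r q x) - p q β| ≤ C₁ / (R : ℝ) ^ 4)
    (hPLW : ∃ (a : ℝ → ℝ) (c : ℝ) (lam Λ W : ℝ → ℕ → ℝ) (C₂ β₁ ℓ₁ : ℝ),
      0 < c ∧ (∀ᶠ β in atTop, a β ≤ c * u β) ∧ 0 < ℓ₁ ∧ 0 ≤ C₂ ∧ (∀ β R, 0 ≤ lam β R) ∧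
      (∀ β : ℝ, β₁ ≤ β → ∀ R : ℕ, 1 ≤ R → (R : ℝ) * a β ≤ ℓ₁ →
        Real.exp (lam β R * Real.exp (lam β R * Λ β R) * W β R - lam β R * θ) ≤ C₂ / (R : ℝ) ^ 4) ∧
      (∀ β : ℝ, β₁ ≤ β → ∀ (L n : ℕ) (q : Fin n → Fin 4 × Fin 4) (x : Fin n → (Fin 4 → ℤ)) (R : ℕ),
        (∀ i, (q i).1 < (q i).2) → 1 ≤ R → (R : ℝ) * a β ≤ ℓ₁ → 4 * R + 8 ≤ L →
        (∀ i j : Fin n, i ≠ j → ∃ k : Fin 4,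
          (2 * (R : ℤ) + 4) ≤ |((((x i k - x j k : ℤ) : ZMod (2 * L + 1))).valMinAbs : ℤ)|) →
        ∃ (κ : Type) (S : Finset κ) (E : κ → Set (LGConfig 4 G)) (w : κ → ℝ) (c : Fin n → κ → ℝ),
          (∀ γ, MeasurableSet (E γ)) ∧ (∀ γ ∈ S, 0 ≤ w γ) ∧ (∀ i, ∀ γ ∈ S, 0 ≤ c i γ) ∧
          (∀ (i : Fin n) (U : GaugeConfig 4 (2 * L + 1) G),
            I β R (q i) (x i) (torusLift (2 * L + 1) U) ≤
              ∑ γ ∈ S, c i γ * (E γ).indicator (fun _ => (1 : ℝ)) (torusLift (2 * L + 1) U)) ∧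
          (∀ γ ∈ S, ∑ i, c i γ ≤ Λ β R) ∧ (∀ i, ∑ γ ∈ S, c i γ * w γ ≤ W β R) ∧
          (∀ A, A ⊆ S → torusE G r β L (fun U => ∏ γ ∈ A, (E γ).indicator (fun _ => (1 : ℝ)) U) ≤
            ∏ γ ∈ A, w γ))) :
    MomentBounds6 G r u := by
  obtain ⟨a, c, C₁, β₁, ℓ₁, P₀, p, hc, hle, hℓ₁, hC₁, hp, hlaw⟩ := hlawW
  obtain ⟨a', c', lam, Λ, W, C₂, β₁', ℓ₁', hc', hle', hℓ₁', hC₂, hlam, hnum, hPL⟩ := hPLW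
  obtain ⟨B, ℓ, hℓ, key⟩ := guards_of_windows (β₁ := β₁) (β₁' := β₁') hc hc' hℓ₁ hℓ₁' hle hle'
  refine momentBounds6_of_temperedLaw_and_polymerLaw r u I (fun _ _ => θ) lam Λ W (β₁ := B) (ℓ₁ := ℓ)
    hℓ hC₁ hC₂ hp hIm hlam ?_ ?_ ?_
  · intro β hβ R hR hRu
    obtain ⟨_, h1', hg⟩ := key β hβ
    exact hnum β h1' R hR (hg R hRu).2
  · intro β hβ R hR hRu q x hq η hη
    obtain ⟨h1, _, hg⟩ := key β hβ
    exact hlaw β h1 R hR (hg R hRu).1 q x hq η hη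
  · intro β hβ L n q x R hq hR hRu hRL hsep
    obtain ⟨_, h1', hg⟩ := key β hβ
    exact hPL β h1' L n q x R hq hR (hg R hRu).2 hRL hsep

end Summit.QuantumFields.YangMills.Cruxes.UVSeamRec.PolymerGlue

end
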